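import Summits.BirchSwinnertonDyer.Rank1Residual.Additive.GordRankOneKatoBranchGrossZagierX3
import Summits.BirchSwinnertonDyer.Rank1Residual.Additive.BranchPAdicGrossZagierUpperHalf
import Summits.BirchSwinnertonDyer.Rank1Residual.Additive.CensusX42BSD
import HarnessLib

/-!
# The (G)-cell at analytic rank ONE, defect 2, ODD branch `p ≡ 3 (mod 4)`, `p ≥ 7`: on the unit-certified
# non-anomalous rows the typed odd-branch `p`-adic Gross–Zagier `BranchPAdicGrossZagierOddAt W p Dh` IS
# `BSD(E,p)` — CERT version, NO main conjecture; X4♯(G-ord) (Kato) and X3♯(G-ord) (Wuthrich Thm. 16)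
# (cell `b2b-bsdres`, team n1011, seat p17 gen 2; r3 GEN 7 sub-target (e) "(G-ord) odd p ≥ 7 — without a
# named writer"; the odd twin of additive-p2 gen 19's `GordRankOneKatoBranchGrossZagier{,X3}.lean` §2–§3
# and the `p ≥ 7` sibling of n1011-p12's `p = 3` file `GordBranchPAdicGrossZagierOddConverseThree.lean`)

HONEST FRAMING (cell `b2b-bsdres`, run/shared/lean/b2b/bsd-rank1-residual/, verbatim in every
file): the goal of the cell is to DELETE the COMBINATION-SHAPED residual classes of the
Birch–Swinnerton-Dyer formula for ALL analytic-rank `≤ 1` elliptic curves over `ℚ` — "full BSD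
formula for every rank `≤ 1` curve in class `C`" assembled STRICTLY from published theorems — so
that the rank-`≤ 1` remainder becomes exactly the CONSTRUCTION-SHAPED classes, which are TYPED
(missing-input `Prop`s), NOT attempted. This is not "finishing BSD". Team n1011 (RESIDUAL-MAP §I
O7-ord, (G-ord) share at the ODD primes `p ≡ 3 (mod 4)`, `p ≥ 7`): prove what is provable now; shrink
each hard class to its core with data; no claim beyond stated classes; research routes; census output
= EVIDENCE / conjecture items, never a Literature fact; RESIDUAL-MAP marks change only by signed
lines. X4♯(G-ord)/X3♯(G-ord) stay CONSTRUCTION-SHAPED; §I O7 stays OPEN; nothing here is booked; no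
label changes. THEOREMS ONLY (NO definition, NO Literature fact, NO `_holds`); named facts enter as
HYPOTHESES: `hK` = Kato 2004 Thm. 17.4 (3) half-eigen reading
(`Wuthrich2014.kato_halfEigenCharIdeal_dvd_cyclotomicPrime_of_surjective`), `hWu` = Wuthrich 2014 Thm. 16
(`Wuthrich2014.thm16_halfEigenCharIdeal_dvd_cyclotomicPrime`), GZK (`hGZK`), modularity (`hmod`,
`hmodD`) — all PUBLISHED; the TYPED input is n1011-p01's `BranchPAdicGrossZagierOddAt W p Dh`
(`@[conjecture]` def: rank `0` PROVED, rank `1` OPEN); the certificate is additive-p2's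
`BranchUnitCertificateAt W p` (ONE finite `p`-adic computation per pair; EVIDENCE; census Q6 / X4-2).
`#print axioms` standard.

COVERAGE (stated first, referee 1 proviso): per pair, `W/ℚ` globally minimal, `ClassX4Gord W p` (resp.
`ClassX3Gord W p`), `semistabilityIndex W p = 2`, `p ≡ 3 (mod 4)` AND `5 ≤ p` (so `p ≥ 7`; the case
`p = 3` is n1011-p12's file over Delbourgo `mainTheorem_three`, NOT restated), `ρ̄_{E,p}` onto (X4
only), `ord_{s=1} L(E,s) = 1`, NON-ANOMALOUS (`ReductionNonAnomalous W p`: Delbourgo's `ℓ_p = 1`), the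
UNIT certificate, `Dh` a (B)-datum (`LeadingTermClauses W p Dh`). NO `¬ W.HasCM` binder (not needed by
the cert-BSD criterion), NO Pal (odd branch), NO tower binder, NO `QuadraticBranchLowerDivisibilityAt` /
`ChiBranchLowerDivisibilityOddAt` (that is p01's IMC-version: `GordBranchPAdicGrossZagierOddConverse.lean`,
`BranchPAdicGrossZagierIff.lean` — disjoint hypotheses, cited BY NAME). Schneider is PROVED
(additive-p2's `ClassX4Gord.schneider_and_padicVal_identity_rankOne_of_katoHalf_of_cert`), NOT assumed.

## What

* §1 `ClassX4Gord.bsdp_rankOne_of_katoHalf_of_cert_of_branchPAdicGrossZagierOdd`: Kato + certificate +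
  the typed ODD-branch pGZ for ONE (B)-datum ⟹ `BSD(E,p)` (certificate: `ord_p(ϖ⁻·[T¹]B⁻) = 0`; pGZ:
  `1 = ord_p q + ord_p Reg_p(E,Dh)`; additive-p2's `ClassX4Gord.bsdp_iff_padicVal_rankOne_of_katoHalf_of_cert`).
* §2 `ClassX4Gord.branchPAdicGrossZagierOddAt_of_bsdp_of_katoHalf_of_cert`: `BSD(E,p)` ⟹ the typed
  odd identity for EVERY (B)-datum and every admissible `(V, C, f, ϖ⁻)` (the quotient is a unit).
* §3 `ClassX4Gord.branchPAdicGrossZagierOddAt_iff_bsdp_of_katoHalf_of_cert` (+ `forall_` form).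
* §4 X3♯(G-ord) twins over `hWu` (NO surj): `ClassX3Gord.bsdp_rankOne_of_wuthrichHalf_of_cert_of_
  branchPAdicGrossZagierOdd`, `ClassX3Gord.branchPAdicGrossZagierOddAt_iff_bsdp_of_wuthrichHalf_of_cert`.

With additive-p2's even file, p12's `p = 3` file and p17's (M) file `PotMultBranchPAdicGrossZagierCertIff`,
the CERT-version iff now stands on EVERY semistable-twist row type of O7-ord with a certificate
(non-anomalous on (G-ord)). Both sides OPEN in rank one; nothing booked; O7 OPEN.

References: [Kato2004Asterisque] Thm. 17.4 (3) (p. 273); [Wuthrich2014] Thm. 16 (p. 397), Lemma 20;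
[Delbourgo2002] Thm. (A), (B) (p. 40), Hypothesis (p. 39); [Delbourgo1998] Thm. 1 (shape);
[MazurTateTeitelbaum1986Invent] §I.13–I.14; [PerrinRiou1987] §1.4 (shape); [Miller2011LMS] Def. 1.1.
-/

noncomputable section

open scoped Classical MatrixGroups ModularForm NumberField

namespace Summit.BirchSwinnertonDyer.Rank1Residual.Additive

open CongruenceSubgroup WeierstrassCurve NumberField Literature.NumberTheory.EllipticCurves
  Literature.NumberTheory.EllipticCurves.ModularForms
  Literature.NumberTheory.EllipticCurves.Rank1Residual
  Literature.NumberTheory.EllipticCurves.Rank1Residual.Typed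
  Literature.NumberTheory.EllipticCurves.Delbourgo2002
  Literature.NumberTheory.GaloisRepresentations Summit.BirchSwinnertonDyer.Rank1Residual.AdditivePotMult
  Summit.BirchSwinnertonDyer.Rank1Residual.X1.MuLambda
  Summit.BirchSwinnertonDyer.Rank1Residual.X1.RankOneParitySqueeze
  IsDedekindDomain

variable {W : WeierstrassCurve ℚ} [W.IsElliptic] [W.IsGloballyMinimal] {p : ℕ} [hp : Fact p.Prime]

omit [W.IsElliptic] [W.IsGloballyMinimal] hp in
/-- `p ≡ 3 (mod 4)`: `p* = −p` and `(p−1)/2` is odd. [folklore] -/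
theorem pStar_eq_neg_and_not_even_of_mod_four_eq_three (hp4 : p % 4 = 3) :
    ((-1 : ℚ) ^ (p / 2) * p) = -(p : ℚ) ∧ ¬ Even (p / 2) := by
  have hodd : ¬ Even (p / 2) := by rw [Nat.not_even_iff_odd]; exact ⟨p / 4, by omega⟩
  refine ⟨?_, hodd⟩
  rw [(Nat.not_even_iff_odd.mp hodd).neg_one_pow]
  ring

omit [W.IsElliptic] [W.IsGloballyMinimal] in
/-- **The certificate at an admissible odd tuple**: for `C • V^{(−p)} = W`, `V` ordinary at `p`, `f` a
newform of `V` and `ϖ⁻` the odd period ratio, `BranchUnitCertificateAt W p` gives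
`ord_p(ϖ⁻·[T¹]B⁻·log_p γ) = 1` and `ϖ⁻·[T¹]B⁻ ≠ 0` (`B⁻ = L_p(f, α, ω^{(p−1)/2}, T)` the minus branch).
[cite: MazurTateTeitelbaum1986Invent, §I.13–I.14] [cite: Iwasawa1972PadicL, §4.4] -/
theorem valuation_minusBranch_coeff_one_of_cert (hp4 : p % 4 = 3) (hcert : BranchUnitCertificateAt W p)
    (V : WeierstrassCurve ℚ) [V.IsElliptic] [V.IsGloballyMinimal] (C : VariableChange ℚ)
    (hC : C • V.quadraticTwist (-(p : ℚ)) = W) (hord : IsOrdinaryAt V p)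
    {N : ℕ} [NeZero N] (f : CuspForm (Gamma0 N) 2) (hf : IsNewformOf V f) (ϖ : ℚ)
    (hϖ : (ϖ : ℝ) * V.imaginaryPeriodRat = minusPeriod f) :
    ((ϖ : ℚ) : ℚ_[p]) * PowerSeries.coeff 1
        (padicLFunctionMinusBranch f ((unitRoot V p : ℤ_[p]) : ℚ_[p]) (p / 2)) ≠ 0 ∧
      (((ϖ : ℚ) : ℚ_[p]) * PowerSeries.coeff 1
          (padicLFunctionMinusBranch f ((unitRoot V p : ℤ_[p]) : ℚ_[p]) (p / 2)) *
        padicLog p (cyclotomicGenerator p : ℚ_[p])).valuation = 1 := by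
  obtain ⟨hps, hodd⟩ := pStar_eq_neg_and_not_even_of_mod_four_eq_three (p := p) hp4
  have hC' : C • V.quadraticTwist ((-1 : ℚ) ^ (p / 2) * p) = W := by rw [hps]; exact hC
  obtain ⟨-, h1⟩ := hcert V C hC' hord f hf ϖ (by rw [if_neg hodd]; exact hϖ)
  rw [if_neg hodd, PowerSeries.coeff_C_mul] at h1
  obtain ⟨hx0, hxv⟩ := CensusX42.valuation_eq_zero_of_norm_eq_one (p := p) h1
  obtain ⟨hlog0, hlogv⟩ := X2.valuation_padicLog_cyclotomicGenerator (p := p) (by omega)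
  exact ⟨hx0, by rw [Padic.valuation_mul hx0 hlog0, hxv, hlogv, zero_add]⟩

omit [W.IsGloballyMinimal] hp in
/-- For `x ∈ ℚ_p` with `ord_p x = 1`, `q ≠ 0` rational and `R ≠ 0`: `x = u·q·R` for a unit `u` iff
`ord_p q + ord_p R = 1`. [folklore] -/
theorem exists_units_mul_iff_padicValRat_add_valuation_eq_one [Fact p.Prime] {x R : ℚ_[p]} {q : ℚ}
    (hx0 : x ≠ 0) (hx : x.valuation = 1) (hq0 : q ≠ 0) (hR0 : R ≠ 0) :
    (∃ u : ℤ_[p]ˣ, x = ((u : ℤ_[p]) : ℚ_[p]) * (q : ℚ_[p]) * R) ↔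
      padicValRat p q + R.valuation = 1 := by
  have hqQ : ((q : ℚ) : ℚ_[p]) ≠ 0 := by exact_mod_cast hq0
  constructor
  · rintro ⟨u, hu⟩
    have hval := congrArg Padic.valuation hu
    rw [hx, Padic.valuation_mul (mul_ne_zero (coe_units_ne_zero p u) hqQ) hR0,
      Padic.valuation_mul (coe_units_ne_zero p u) hqQ, valuation_coe_units_eq_zero, zero_add,
      Padic.valuation_ratCast] at hval
    linarith
  · intro h
    set den : ℚ_[p] := ((q : ℚ) : ℚ_[p]) * R with hden
    have hden0 : den ≠ 0 := mul_ne_zero hqQ hR0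
    have hdenv : den.valuation = 1 := by
      rw [hden, Padic.valuation_mul hqQ hR0, Padic.valuation_ratCast]; exact h
    have hcancel : x / den * den = x := div_mul_cancel₀ x hden0
    have hxval : (x / den).valuation = 0 := by
      have hv := congrArg Padic.valuation hcancel
      rw [Padic.valuation_mul (div_ne_zero hx0 hden0) hden0, hx, hdenv] at hv
      linarith
    obtain ⟨u, hu⟩ := exists_units_coe_eq_of_valuation_eq_zero (div_ne_zero hx0 hden0) hxval
    refine ⟨u, ?_⟩
    rw [hu, mul_assoc, ← hden]
    exact hcancel.symm

/-! ### §1 Kato + certificate + typed ODD-branch `p`-adic Gross–Zagier for ONE (B)-datum ⟹ `BSD(E,p)` -/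

/-- **X4♯(G-ord) ∩ `I₀*` ∩ {`ρ̄` onto}, `p ≡ 3 (mod 4)`, `p ≥ 7`, `r_an = 1`, NON-ANOMALOUS, UNIT
certificate: Kato's divisibility and the typed ODD-branch `p`-adic Gross–Zagier for ONE (B)-datum give
`BSD(E,p)`** — no main conjecture: the certificate pins `ord_p(ϖ⁻·[T¹]B⁻·log_p γ) = 1` at the good
ordinary twist model `E♭ = E ⊗ χ_{−p}`, so pGZ reads `ord_p q + ord_p Reg_p(E,Dh) = 1`, which is
additive-p2's criterion `ClassX4Gord.bsdp_iff_padicVal_rankOne_of_katoHalf_of_cert` (Schneider PROVED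
there). [cite: Kato2004Asterisque, Thm. 17.4 (3) (p. 273)] [cite: Delbourgo2002, Theorem (B) (p. 40)]
[cite: Delbourgo1998, Thm. 1 (shape)] [cite: Miller2011LMS, Def. 1.1] -/
theorem ClassX4Gord.bsdp_rankOne_of_katoHalf_of_cert_of_branchPAdicGrossZagierOdd
    (hK : Wuthrich2014.kato_halfEigenCharIdeal_dvd_cyclotomicPrime_of_surjective)
    (hmodD : nonempty_modularParametrizationData)
    (hGZK : rank_eq_analyticRank_of_analyticRank_le_one) (hmod : hasEntireLFunction_rat)
    (hX : ClassX4Gord W p) (hp4 : p % 4 = 3) (hp5 : 5 ≤ p)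
    (he : semistabilityIndex W p = 2) (hsurj : Surj W p) (hr : W.analyticRank = 1)
    (hna : ReductionNonAnomalous W p) (hcert : BranchUnitCertificateAt W p)
    {Dh : PAdicHeightData W p} (hB : LeadingTermClauses W p Dh)
    (hGZ : BranchPAdicGrossZagierOddAt W p Dh) : BSDp W p := by
  obtain ⟨hps, -⟩ := pStar_eq_neg_and_not_even_of_mod_four_eq_three (p := p) hp4
  obtain ⟨V, iV, iVm, C, hV, hC⟩ := hX.exists_goodOrd_pStar_twist_model W p he
  haveI : NeZero (V.conductorNorm ℤ) := ⟨(V.conductorNorm_pos_holds).ne'⟩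
  obtain ⟨Dm⟩ := hmodD V
  obtain ⟨ϖ, -, hϖ⟩ := exists_rat_mul_imaginaryPeriodRat_eq_minusPeriod Dm
  have hC' : C • V.quadraticTwist (-(p : ℚ)) = W := by rw [← hps]; exact hC
  have hord : IsOrdinaryAt V p :=
    isOrdinaryAt_of_goodOrd_or_mult_of_model_twist W V (pStar_ne_zero p) ⟨C, hC⟩
      (padicValRat_j_nonneg_of_typeGOrd W p hX.typeGOrd) (Or.inl hV)
  obtain ⟨hx0, hxv⟩ := valuation_minusBranch_coeff_one_of_cert hp4 hcert V C hC' hord Dm.f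
    Dm.isNewformOf ϖ hϖ
  -- pGZ at rank 1
  obtain ⟨hmw, -⟩ := hGZK W (by rw [hr])
  have hr1 : W.mordellWeilRank = 1 := by rw [hmw, hr]
  obtain ⟨u, q, hLq, hgz⟩ := hGZ V hp4 ⟨C, hC'⟩ hV Dm.isNewformOf ϖ hϖ
  rw [hr1, pow_one] at hgz
  have hReg : padicRegulator Dh ≠ 0 :=
    (hX.schneider_and_padicVal_identity_rankOne_of_katoHalf_of_cert hK hmodD hGZK hp5 he hsurj hr hcert
      hB).1
  have hq0 : q ≠ 0 := by
    rintro rfl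
    rw [Rat.cast_zero, zero_mul, zero_mul] at hLq
    exact W.leadingLCoeff_ne_zero_holds (hmod W) hLq
  obtain ⟨hlog0, -⟩ := X2.valuation_padicLog_cyclotomicGenerator (p := p) (by omega)
  have hv : padicValRat p q + (padicRegulator Dh).valuation = 1 :=
    (exists_units_mul_iff_padicValRat_add_valuation_eq_one (mul_ne_zero hx0 hlog0) hxv hq0 hReg).mp
      ⟨u, hgz⟩
  exact (hX.bsdp_iff_padicVal_rankOne_of_katoHalf_of_cert hK hmodD hGZK hmod hp5 he hsurj hr hna hcert hB
    hLq).mpr hv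

/-! ### §2 `BSD(E,p)` ⟹ the typed ODD-branch identity for EVERY (B)-datum (CERT version) -/

/-- **X4♯(G-ord) ∩ `I₀*` ∩ {`ρ̄` onto}, `p ≥ 5`, `r_an = 1`, NON-ANOMALOUS, UNIT certificate:
`BSD(E,p)` ⟹ `BranchPAdicGrossZagierOddAt W p Dh` for EVERY (B)-datum `Dh`** (the typed statement is
itself guarded by `p ≡ 3 (mod 4)`): for every admissible `(V, C, f, ϖ⁻)` the certificate gives
`ord_p(ϖ⁻·[T¹]B⁻·log_p γ) = 1`, `BSD(E,p)` gives `ord_p(q·Reg_p(E,Dh)) = 1` (`q := #Ш_an·∏c/#T²`), so the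
quotient is a unit. CERT version (p01's IMC-version converse is
`ClassX4Gord.branchPAdicGrossZagierOddAt_of_bsdp_of_chiBranchLowerOdd_of_katoHalf`).
[cite: Kato2004Asterisque, Thm. 17.4 (3) (p. 273)] [cite: Delbourgo2002, Theorem (B) (p. 40)]
[cite: PerrinRiou1987, §1.4 (shape)] [cite: Miller2011LMS, Def. 1.1] -/
theorem ClassX4Gord.branchPAdicGrossZagierOddAt_of_bsdp_of_katoHalf_of_cert
    (hK : Wuthrich2014.kato_halfEigenCharIdeal_dvd_cyclotomicPrime_of_surjective)
    (hmodD : nonempty_modularParametrizationData)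
    (hGZK : rank_eq_analyticRank_of_analyticRank_le_one) (hmod : hasEntireLFunction_rat)
    (hX : ClassX4Gord W p) (hp5 : 5 ≤ p) (he : semistabilityIndex W p = 2) (hsurj : Surj W p)
    (hr : W.analyticRank = 1) (hna : ReductionNonAnomalous W p) (hcert : BranchUnitCertificateAt W p)
    (hbsd : BSDp W p) {Dh : PAdicHeightData W p} (hB : LeadingTermClauses W p Dh) :
    BranchPAdicGrossZagierOddAt W p Dh := by
  obtain ⟨hmw, hfinSha⟩ := hGZK W (by rw [hr])
  have hr1 : W.mordellWeilRank = 1 := by rw [hmw, hr]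
  haveI : Finite W.sha := hfinSha
  have hReg : padicRegulator Dh ≠ 0 :=
    (hX.schneider_and_padicVal_identity_rankOne_of_katoHalf_of_cert hK hmodD hGZK hp5 he hsurj hr hcert
      hB).1
  -- `q` with `L'(E,1) = q·Ω_E·Reg_∞` from the rationality of `#Ш_an` under `BSD(E,p)`
  obtain ⟨s, hs, -⟩ := missingPPartAt_of_bsdp W p hbsd
  have hΩpos : 0 < W.realPeriodRat := W.realPeriodRat_pos_holds
  have hT0 : W.torsionOrder ≠ 0 := (W.torsionOrder_pos_holds).ne'
  have hPpos : 0 < W.tamagawaProduct := W.tamagawaProduct_pos_holds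
  have hRpos : 0 < W.regulator := regulator_pos_holds W
  set q : ℚ := s * (W.tamagawaProduct : ℚ) / (W.torsionOrder : ℚ) ^ 2 with hq_def
  have hLq : W.leadingLCoeff = (q : ℂ) * (W.realPeriodRat : ℂ) * (W.regulator : ℂ) := by
    have hΩC : (W.realPeriodRat : ℂ) ≠ 0 := by exact_mod_cast hΩpos.ne'
    have hTC : (W.torsionOrder : ℂ) ≠ 0 := by exact_mod_cast hT0
    have hPC : (W.tamagawaProduct : ℂ) ≠ 0 := by exact_mod_cast hPpos.ne'
    have hRC : (W.regulator : ℂ) ≠ 0 := by exact_mod_cast hRpos.ne'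
    have h := hs
    rw [shaAn_def, div_eq_iff (mul_ne_zero (mul_ne_zero hΩC hPC) hRC)] at h
    rw [hq_def]
    push_cast
    field_simp
    linear_combination h
  have hq0 : q ≠ 0 := by
    intro h0
    rw [h0, Rat.cast_zero, zero_mul, zero_mul] at hLq
    exact W.leadingLCoeff_ne_zero_holds (hmod W) hLq
  have hv : padicValRat p q + (padicRegulator Dh).valuation = 1 :=
    (hX.bsdp_iff_padicVal_rankOne_of_katoHalf_of_cert hK hmodD hGZK hmod hp5 he hsurj hr hna hcert hB
      hLq).mp hbsd
  intro V iV iVm N _ f hp4 hVW hV hf ϖ hϖ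
  obtain ⟨C, hC⟩ := hVW
  obtain ⟨hps, -⟩ := pStar_eq_neg_and_not_even_of_mod_four_eq_three (p := p) hp4
  have hord : IsOrdinaryAt V p :=
    isOrdinaryAt_of_goodOrd_or_mult_of_model_twist W V (pStar_ne_zero p) ⟨C, by rw [hps]; exact hC⟩
      (padicValRat_j_nonneg_of_typeGOrd W p hX.typeGOrd) (Or.inl hV)
  obtain ⟨hx0, hxv⟩ := valuation_minusBranch_coeff_one_of_cert hp4 hcert V C hC hord f hf ϖ hϖ
  obtain ⟨hlog0, -⟩ := X2.valuation_padicLog_cyclotomicGenerator (p := p) (by omega)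
  obtain ⟨u, hu⟩ :=
    (exists_units_mul_iff_padicValRat_add_valuation_eq_one (mul_ne_zero hx0 hlog0) hxv hq0 hReg).mpr hv
  exact ⟨u, q, hLq, by rw [hr1, pow_one]; exact hu⟩

/-! ### §3 On the unit-certified non-anomalous rows the typed ODD-branch pGZ IS `BSD(E,p)` -/

/-- **X4♯(G-ord) ∩ `I₀*` ∩ {`ρ̄` onto}, `p ≡ 3 (mod 4)`, `p ≥ 7`, `r_an = 1`, NON-ANOMALOUS, UNIT
certificate, `Dh` a (B)-datum: `BranchPAdicGrossZagierOddAt W p Dh ↔ BSDp W p`.** The typed odd-branch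
`p`-adic Gross–Zagier at the additive prime (RESIDUAL-MAP §I O7-ord, OPEN in rank one) and the `p`-part
of BSD are ONE statement on these rows (census X4-2 / Q6 odd records measure the certificate). With
additive-p2's even file (`p ≡ 1 (mod 4)`) and p12's `p = 3` file this covers every (G-ord) certificate
row type. [cite: Kato2004Asterisque, Thm. 17.4 (3) (p. 273)] [cite: Delbourgo2002, Theorem (B) (p. 40)]
[cite: Delbourgo1998, Thm. 1 (shape)] [cite: Miller2011LMS, Def. 1.1] -/
theorem ClassX4Gord.branchPAdicGrossZagierOddAt_iff_bsdp_of_katoHalf_of_cert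
    (hK : Wuthrich2014.kato_halfEigenCharIdeal_dvd_cyclotomicPrime_of_surjective)
    (hmodD : nonempty_modularParametrizationData)
    (hGZK : rank_eq_analyticRank_of_analyticRank_le_one) (hmod : hasEntireLFunction_rat)
    (hX : ClassX4Gord W p) (hp4 : p % 4 = 3) (hp5 : 5 ≤ p)
    (he : semistabilityIndex W p = 2) (hsurj : Surj W p) (hr : W.analyticRank = 1)
    (hna : ReductionNonAnomalous W p) (hcert : BranchUnitCertificateAt W p)
    {Dh : PAdicHeightData W p} (hB : LeadingTermClauses W p Dh) :
    BranchPAdicGrossZagierOddAt W p Dh ↔ BSDp W p :=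
  ⟨fun hGZ ↦ hX.bsdp_rankOne_of_katoHalf_of_cert_of_branchPAdicGrossZagierOdd hK hmodD hGZK hmod hp4 hp5
      he hsurj hr hna hcert hB hGZ,
    fun hbsd ↦ hX.branchPAdicGrossZagierOddAt_of_bsdp_of_katoHalf_of_cert hK hmodD hGZK hmod hp5 he hsurj
      hr hna hcert hbsd hB⟩

/-- **`∀ Dh` form** (X4♯(G-ord), `p ≡ 3 (mod 4)`, `p ≥ 7`, certificate rows): for EVERY (B)-datum,
`BranchPAdicGrossZagierOddAt W p Dh ↔ BSDp W p`. [cite: Miller2011LMS, Def. 1.1] -/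
theorem ClassX4Gord.forall_branchPAdicGrossZagierOddAt_iff_bsdp_of_katoHalf_of_cert
    (hK : Wuthrich2014.kato_halfEigenCharIdeal_dvd_cyclotomicPrime_of_surjective)
    (hmodD : nonempty_modularParametrizationData)
    (hGZK : rank_eq_analyticRank_of_analyticRank_le_one) (hmod : hasEntireLFunction_rat)
    (hX : ClassX4Gord W p) (hp4 : p % 4 = 3) (hp5 : 5 ≤ p)
    (he : semistabilityIndex W p = 2) (hsurj : Surj W p) (hr : W.analyticRank = 1)
    (hna : ReductionNonAnomalous W p) (hcert : BranchUnitCertificateAt W p) :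
    ∀ Dh : PAdicHeightData W p, LeadingTermClauses W p Dh →
      (BranchPAdicGrossZagierOddAt W p Dh ↔ BSDp W p) :=
  fun _ hB ↦ hX.branchPAdicGrossZagierOddAt_iff_bsdp_of_katoHalf_of_cert hK hmodD hGZK hmod hp4 hp5 he
    hsurj hr hna hcert hB

/-! ### §4 X3♯(G-ord) twins (reducible `E[p]`; Wuthrich 2014 Thm. 16, NO surj) -/

/-- **X3♯(G-ord) ∩ `I₀*`, `p ≡ 3 (mod 4)`, `p ≥ 7`, `r_an = 1`, NON-ANOMALOUS, UNIT certificate: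
Wuthrich's divisibility and the typed ODD-branch pGZ for ONE (B)-datum give `BSD(E,p)`** (no Kolyvagin,
no main conjecture; additive-p2's `ClassX3Gord.bsdp_iff_padicVal_rankOne_of_wuthrichHalf_of_cert`).
[cite: Wuthrich2014, Thm. 16 (p. 397)] [cite: Delbourgo2002, Theorem (B) (p. 40)] [cite: Miller2011LMS, Def. 1.1] -/
theorem ClassX3Gord.bsdp_rankOne_of_wuthrichHalf_of_cert_of_branchPAdicGrossZagierOdd
    (hWu : Wuthrich2014.thm16_halfEigenCharIdeal_dvd_cyclotomicPrime)
    (hmodD : nonempty_modularParametrizationData)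
    (hGZK : rank_eq_analyticRank_of_analyticRank_le_one) (hmod : hasEntireLFunction_rat)
    (hX : ClassX3Gord W p) (hp4 : p % 4 = 3) (hp5 : 5 ≤ p)
    (he : semistabilityIndex W p = 2) (hr : W.analyticRank = 1)
    (hna : ReductionNonAnomalous W p) (hcert : BranchUnitCertificateAt W p)
    {Dh : PAdicHeightData W p} (hB : LeadingTermClauses W p Dh)
    (hGZ : BranchPAdicGrossZagierOddAt W p Dh) : BSDp W p := by
  obtain ⟨hps, -⟩ := pStar_eq_neg_and_not_even_of_mod_four_eq_three (p := p) hp4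
  obtain ⟨V, iV, iVm, C, hV, hC⟩ := hX.exists_goodOrd_pStar_twist_model W p (by omega) he
  haveI : NeZero (V.conductorNorm ℤ) := ⟨(V.conductorNorm_pos_holds).ne'⟩
  obtain ⟨Dm⟩ := hmodD V
  obtain ⟨ϖ, -, hϖ⟩ := exists_rat_mul_imaginaryPeriodRat_eq_minusPeriod Dm
  have hC' : C • V.quadraticTwist (-(p : ℚ)) = W := by rw [← hps]; exact hC
  have hord : IsOrdinaryAt V p :=
    isOrdinaryAt_of_goodOrd_or_mult_of_model_twist W V (pStar_ne_zero p) ⟨C, hC⟩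
      (padicValRat_j_nonneg_of_typeGOrd W p hX.typeGOrd) (Or.inl hV)
  obtain ⟨hx0, hxv⟩ := valuation_minusBranch_coeff_one_of_cert hp4 hcert V C hC' hord Dm.f
    Dm.isNewformOf ϖ hϖ
  obtain ⟨hmw, -⟩ := hGZK W (by rw [hr])
  have hr1 : W.mordellWeilRank = 1 := by rw [hmw, hr]
  obtain ⟨u, q, hLq, hgz⟩ := hGZ V hp4 ⟨C, hC'⟩ hV Dm.isNewformOf ϖ hϖ
  rw [hr1, pow_one] at hgz
  have hReg : padicRegulator Dh ≠ 0 :=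
    (hX.schneider_and_padicVal_identity_rankOne_of_wuthrichHalf_of_cert hWu hmodD hGZK hp5 he hr hcert
      hB).1
  have hq0 : q ≠ 0 := by
    rintro rfl
    rw [Rat.cast_zero, zero_mul, zero_mul] at hLq
    exact W.leadingLCoeff_ne_zero_holds (hmod W) hLq
  obtain ⟨hlog0, -⟩ := X2.valuation_padicLog_cyclotomicGenerator (p := p) (by omega)
  have hv : padicValRat p q + (padicRegulator Dh).valuation = 1 :=
    (exists_units_mul_iff_padicValRat_add_valuation_eq_one (mul_ne_zero hx0 hlog0) hxv hq0 hReg).mp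
      ⟨u, hgz⟩
  exact (hX.bsdp_iff_padicVal_rankOne_of_wuthrichHalf_of_cert hWu hmodD hGZK hmod hp5 he hr hna hcert hB
    hLq).mpr hv

/-- **X3♯(G-ord) ∩ `I₀*`, `p ≡ 3 (mod 4)`, `p ≥ 7`, `r_an = 1`, NON-ANOMALOUS, UNIT certificate, `Dh`
a (B)-datum: `BranchPAdicGrossZagierOddAt W p Dh ↔ BSDp W p`** (Wuthrich Thm. 16; NO surj, NO
Kolyvagin, NO main conjecture). [cite: Wuthrich2014, Thm. 16 (p. 397)] [cite: Delbourgo2002, Theorem (B) (p. 40)]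
[cite: Miller2011LMS, Def. 1.1] -/
theorem ClassX3Gord.branchPAdicGrossZagierOddAt_iff_bsdp_of_wuthrichHalf_of_cert
    (hWu : Wuthrich2014.thm16_halfEigenCharIdeal_dvd_cyclotomicPrime)
    (hmodD : nonempty_modularParametrizationData)
    (hGZK : rank_eq_analyticRank_of_analyticRank_le_one) (hmod : hasEntireLFunction_rat)
    (hX : ClassX3Gord W p) (hp4 : p % 4 = 3) (hp5 : 5 ≤ p)
    (he : semistabilityIndex W p = 2) (hr : W.analyticRank = 1)
    (hna : ReductionNonAnomalous W p) (hcert : BranchUnitCertificateAt W p)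
    {Dh : PAdicHeightData W p} (hB : LeadingTermClauses W p Dh) :
    BranchPAdicGrossZagierOddAt W p Dh ↔ BSDp W p := by
  refine ⟨fun hGZ ↦ hX.bsdp_rankOne_of_wuthrichHalf_of_cert_of_branchPAdicGrossZagierOdd hWu hmodD hGZK
    hmod hp4 hp5 he hr hna hcert hB hGZ, fun hbsd ↦ ?_⟩
  obtain ⟨hmw, hfinSha⟩ := hGZK W (by rw [hr])
  have hr1 : W.mordellWeilRank = 1 := by rw [hmw, hr]
  haveI : Finite W.sha := hfinSha
  have hReg : padicRegulator Dh ≠ 0 :=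
    (hX.schneider_and_padicVal_identity_rankOne_of_wuthrichHalf_of_cert hWu hmodD hGZK hp5 he hr hcert
      hB).1
  obtain ⟨s, hs, -⟩ := missingPPartAt_of_bsdp W p hbsd
  have hΩpos : 0 < W.realPeriodRat := W.realPeriodRat_pos_holds
  have hT0 : W.torsionOrder ≠ 0 := (W.torsionOrder_pos_holds).ne'
  have hPpos : 0 < W.tamagawaProduct := W.tamagawaProduct_pos_holds
  have hRpos : 0 < W.regulator := regulator_pos_holds W
  set q : ℚ := s * (W.tamagawaProduct : ℚ) / (W.torsionOrder : ℚ) ^ 2 with hq_def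
  have hLq : W.leadingLCoeff = (q : ℂ) * (W.realPeriodRat : ℂ) * (W.regulator : ℂ) := by
    have hΩC : (W.realPeriodRat : ℂ) ≠ 0 := by exact_mod_cast hΩpos.ne'
    have hTC : (W.torsionOrder : ℂ) ≠ 0 := by exact_mod_cast hT0
    have hPC : (W.tamagawaProduct : ℂ) ≠ 0 := by exact_mod_cast hPpos.ne'
    have hRC : (W.regulator : ℂ) ≠ 0 := by exact_mod_cast hRpos.ne'
    have h := hs
    rw [shaAn_def, div_eq_iff (mul_ne_zero (mul_ne_zero hΩC hPC) hRC)] at h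
    rw [hq_def]
    push_cast
    field_simp
    linear_combination h
  have hq0 : q ≠ 0 := by
    intro h0
    rw [h0, Rat.cast_zero, zero_mul, zero_mul] at hLq
    exact W.leadingLCoeff_ne_zero_holds (hmod W) hLq
  have hv : padicValRat p q + (padicRegulator Dh).valuation = 1 :=
    (hX.bsdp_iff_padicVal_rankOne_of_wuthrichHalf_of_cert hWu hmodD hGZK hmod hp5 he hr hna hcert hB
      hLq).mp hbsd
  intro V iV iVm N _ f hp4' hVW hV hf ϖ hϖ
  obtain ⟨C, hC⟩ := hVW
  obtain ⟨hps, -⟩ := pStar_eq_neg_and_not_even_of_mod_four_eq_three (p := p) hp4'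
  have hord : IsOrdinaryAt V p :=
    isOrdinaryAt_of_goodOrd_or_mult_of_model_twist W V (pStar_ne_zero p) ⟨C, by rw [hps]; exact hC⟩
      (padicValRat_j_nonneg_of_typeGOrd W p hX.typeGOrd) (Or.inl hV)
  obtain ⟨hx0, hxv⟩ := valuation_minusBranch_coeff_one_of_cert hp4' hcert V C hC hord f hf ϖ hϖ
  obtain ⟨hlog0, -⟩ := X2.valuation_padicLog_cyclotomicGenerator (p := p) (by omega)
  obtain ⟨u, hu⟩ :=
    (exists_units_mul_iff_padicValRat_add_valuation_eq_one (mul_ne_zero hx0 hlog0) hxv hq0 hReg).mpr hv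
  exact ⟨u, q, hLq, by rw [hr1, pow_one]; exact hu⟩

end Summit.BirchSwinnertonDyer.Rank1Residual.Additive

end
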